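import Mathlib
import Summits.HodgeConjecture.HodgeConjecture.Theorems.K2E1SpectralTermsDiscreteHalf        -- ★ E1: `DiscreteClass`, `mk`, `out`, `areUnitarilyEquivalent_out`
import Summits.HodgeConjecture.HodgeConjecture.Theorems.K2E1EvpOfAutomorphicClass           -- ★ E1: `evpAtIntegralLevel`, `evpOfClass_congr`
import Summits.HodgeConjecture.HodgeConjecture.Theorems.F0P3ClassTokenChoice               -- ★ `clFinChoice`, `admUnitConstituents`
import Summits.HodgeConjecture.HodgeConjecture.Theorems.F0P3RamClsOfRecordTransport        -- ★ `admUnitConstituents_eq_of_areUnitarilyEquivalent`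
import HarnessLib

/-!
# R90-TF · S10 — THE CHOSEN LOCAL CLASSES AND THE E.V.P. OF A DISCRETE CLASS DO NOT DEPEND ON THE REPRESENTATIVE
# (`clFinChoice (mk P).out v = clFinChoice P v`; `t((mk P).out) = t(P)` at the integral levels off `S`)

Cell `hodgecm-mathlib`, crux H413 (`stmt-HodgeConjecture-24833`, lane `--supports … --as helper`), route of record `HCCMUnconditional`; programme R90-TF, section S10
(base `R90-C138`), typed by R90-C138-typ2 (g2) as PREP for FILE F `Lines/R90_S10_TwistedDatumF.lean` (the honest twisted comparison datum `𝔨` of record, HEADS-D.v3 §K.1):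
the junction requirement J3-R3 (S5, `PREFLIGHT-J3-pins` ad55226fdc7d004f) asks `𝔨.germRep (mk P) = evpAtIntegralLevel L 3 H (clFinChoice P) S hP` for the germ field
`germRep : DiscreteClass … → EigenvaluePackage S …` (J3-R1: `𝔊.Rep := DiscreteClass (G3 L) μA`, ★ E1), which F can only DEFINE through the chosen representative
`c.out` of the class.  THIS FILE is the bridge: the chosen local class ★ `clFinChoice P v` reads `P` only through ★ `admUnitConstituents P v`, invariant under unitary
equivalence (★ `admUnitConstituents_eq_of_areUnitarilyEquivalent`), and `(mk P).out ≃ P` unitarily (★ `DiscreteClass.areUnitarilyEquivalent_out`); hence the e.v.p.'s at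
the integral levels agree (★ `evpOfClass_congr`).  The ★ twin for the F0P3 class tokens `rep (cl P)` is `F0P3LettersRouting.clFinChoice_rep_cl`; here the E1 quotient
`DiscreteClass` (the `𝔊.Rep` of record).  THEOREMS ONLY (no `def`, no instance, no notation, no `sorry`); never imports a `Cruxes/…/Lines` module.
HONEST LABEL: HC_CM is proved only modulo the 7 printed citations (2 remaining named inputs: hLiu418 = stmt-HodgeConjecture-24832, h413 = stmt-HodgeConjecture-24833)
— until rung 0 closes.  Representative book-keeping; closes no socket. [cite: Rogawski1990, §13.6 p. 209; §14.5 p. 237] [cite: Dixmier1977, §13.1.3]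
-/

set_option linter.dupNamespace false

noncomputable section

namespace Summit.HodgeConjecture.HodgeConjecture.R90.S10

open MeasureTheory NumberField IsDedekindDomain
open Literature.NumberTheory.Automorphic Literature.NumberTheory.Automorphic.UnitaryGroup
open Summit.HodgeConjecture.HodgeConjecture.Cruxes.H413.K2E1SpectralTermsDiscreteHalf
open Summit.HodgeConjecture.HodgeConjecture.Cruxes.H413.K2E1EvpOfAutomorphicClass
open Summit.HodgeConjecture.HodgeConjecture.Cruxes.H413.F0P3ClassTokenChoice
open Summit.HodgeConjecture.HodgeConjecture.Cruxes.H413.F0P3RamClsOfRecord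

variable {L : Type} [Field L] [NumberField L] [IsCMField L] {H : Matrix (Fin 3) (Fin 3) L}
variable {μ : Measure (adelicGroupData (↥(maximalRealSubfield L)) L (IsCMField.complexConj L) 3 H).automorphicQuotient}
  [(adelicGroupData (↥(maximalRealSubfield L)) L (IsCMField.complexConj L) 3 H).IsAutomorphicMeasure μ]

/-- **The chosen local class of a discrete class does not depend on the representative**: `clFinChoice (mk P).out v = clFinChoice P v`.
[cite: Rogawski1990, §14.5 p. 237] [cite: Dixmier1977, §13.1.3] -/
theorem clFinChoice_out_mk (P : DiscreteAutomorphicRep (adelicGroupData (↥(maximalRealSubfield L)) L (IsCMField.complexConj L) 3 H) μ)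
    (v : HeightOneSpectrum (𝓞 ↥(maximalRealSubfield L))) :
    clFinChoice (DiscreteClass.mk P).out v = clFinChoice P v := by
  unfold clFinChoice
  rw [admUnitConstituents_eq_of_areUnitarilyEquivalent (DiscreteClass.areUnitarilyEquivalent_out (P := P) rfl).symm v]

/-- **Sphericity off `S` transports to the representative's chosen classes.** [cite: Rogawski1990, §13.6 p. 209] -/
theorem isSpherical_clFinChoice_out_mk (P : DiscreteAutomorphicRep (adelicGroupData (↥(maximalRealSubfield L)) L (IsCMField.complexConj L) 3 H) μ)
    (S : Set (HeightOneSpectrum (𝓞 ↥(maximalRealSubfield L))))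
    (hP : ∀ v, v ∉ S → (clFinChoice P v).IsSpherical (cmLocalIntegralLevel L 3 H v)) :
    ∀ v, v ∉ S → (clFinChoice (DiscreteClass.mk P).out v).IsSpherical (cmLocalIntegralLevel L 3 H v) := by
  intro v hv
  rw [clFinChoice_out_mk]
  exact hP v hv

/-- **The e.v.p. of a discrete class at the integral levels off `S` does not depend on the representative**: for `P` with chosen classes spherical off `S`,
`t((mk P).out) = t(P)` as ★ `EigenvaluePackage`s (E1 ★ `evpAtIntegralLevel`) — the bridge that makes FILE F's `germRep (mk P)` (defined through `(mk P).out`) equal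
to the J3-R3 body `evpAtIntegralLevel L 3 H (clFinChoice P) S hP`. [cite: Rogawski1990, §13.6 p. 209] [cite: CartierCorvallis1979, §IV.1 Cor. 4.1] -/
theorem evpAtIntegralLevel_clFinChoice_out_mk (P : DiscreteAutomorphicRep (adelicGroupData (↥(maximalRealSubfield L)) L (IsCMField.complexConj L) 3 H) μ)
    (S : Set (HeightOneSpectrum (𝓞 ↥(maximalRealSubfield L))))
    (hP : ∀ v, v ∉ S → (clFinChoice P v).IsSpherical (cmLocalIntegralLevel L 3 H v))
    (hP' : ∀ v, v ∉ S → (clFinChoice (DiscreteClass.mk P).out v).IsSpherical (cmLocalIntegralLevel L 3 H v)) :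
    evpAtIntegralLevel L 3 H (fun v => clFinChoice (DiscreteClass.mk P).out v) S hP' = evpAtIntegralLevel L 3 H (fun v => clFinChoice P v) S hP := by
  unfold evpAtIntegralLevel
  exact evpOfClass_congr (L := L) (N := 3) (H := H) (fun v => cmLocalIntegralLevel L 3 H v) hP' hP fun v _ => clFinChoice_out_mk P v

end Summit.HodgeConjecture.HodgeConjecture.R90.S10

end
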